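import Summits.BirchSwinnertonDyer.Rank1Residual.GaloisImage.SakamotoN11InstanceLevelOneInputs
import Literature.NumberTheory.GaloisCohomology.Sakamoto2024KolyvaginFittingIdeal
import HarnessLib

/-!
# The N11 instance of Sakamoto 2024 Thm. 4.4 (2) (`I_R(κ_d) = Fitt⁰(N_d^∨)`, unfolded) for
# `(E[3^{k+1}], 𝓕_can)` — every level from surj(3) with binders, the tower form, and LEVEL ONE
# assembled (cell `b2b-bsdres`, team n1011, rows T-a3-F1 / T-a5x; consumer of n1011-p11's R1-22
# named fact `Sakamoto2024.kolyvaginSystems_idealOfBasis_eq_fittingIdeal_zmod_three_pow`; seat p13)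

HONEST FRAMING (cell `b2b-bsdres`, run/shared/lean/b2b/bsd-rank1-residual/, verbatim in every
file): the goal of the cell is to DELETE the COMBINATION-SHAPED residual classes of the
Birch–Swinnerton-Dyer formula for ALL analytic-rank `≤ 1` elliptic curves over `ℚ` — "full BSD
formula for every rank `≤ 1` curve in class `C`" assembled STRICTLY from published theorems — so
that the rank-`≤ 1` remainder becomes exactly the CONSTRUCTION-SHAPED classes, which are TYPED
(missing-input `Prop`s), NOT attempted. This is not "finishing BSD". Team n1011 (N10/N11, the
additive block `X4 ∧ p = 3`): research route; no claim beyond the stated classes; the label X4 and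
the mark of RESIDUAL-MAP §I N11 are UNCHANGED by this file; nothing is booked. Theorems only: no
definition, no named fact is minted. Every end theorem is CONDITIONAL on the tree's named fact
`Literature.NumberTheory.GaloisCohomology.Sakamoto2024.kolyvaginSystems_idealOfBasis_eq_fittingIdeal_zmod_three_pow`
(R. Sakamoto, JTNB 36 (2024) Thm. 4.4 (2) for `R = ℤ/3^m`, `K = ℚ`, unfolded to cardinalities;
n1011-p11, R1-22; hypothesis `hS24₂`, debt of the tree), and the Weil-discharged / assembled forms
on Tate's local Euler–Poincaré characteristic (named fact, hypothesis `hEP`) — all explicit.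

## What and why

Thm. 4.4 (2) in p11's unfolding: for a BASIS `κ` of the free rank-one `ℤ/3^m`-module `KS₁(T, 𝓕, 𝒫)`
(`AddSubgroup.zmultiples κ = ⊤`) and a level `d ∈ 𝒩`, with `N_d = H¹_{𝓕(d)^*}(ℚ, T^∨(1))` the dual
Selmer group for a Poitou–Tate family `inv'` at the FULL level `3^m`: if `#N_d ∣ 3^m` then
`ord(κ_d) · #N_d = 3^m`, and if `3^m ∣ #N_d` then `κ_d = 0`.  This file instantiates it at
`T = E[3^{k+1}]` (`geomTorsion W ((3:ℤ)^k·3)`), `T̄ = E[3]`, `𝓕 = 𝓕_can = propagatedSelmerStructure W 3 k`,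
discharging exactly what p255331 / p260356 discharge for conclusion (1) (Sakamoto's residual pair,
the free `ℤ/3^{k+1}`-module, (H.1) from surj(3), cartesian, `𝓕̄ = propagatedSelmerStructureOne`):

* `kolyvaginSystems_idealOfBasis_propagatedSelmerStructure_of_surj` — EVERY level `k`, from surj(3),
  all other hypotheses as binders (`τ`, (H.3), `θ`, the residual Poitou–Tate family `inv` ×4, `S`,
  `hunr`, core rank, coisotropy, the datum, the full-level family `inv'` ×4).
* `kolyvaginSystems_idealOfBasis_propagatedSelmerStructure_weil_of_surj` — (H.SD)/coisotropy
  discharged by the Weil choice of `θ` (n1011-p18's pattern; binder `hEP` on the finite places of `S`).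
* `kolyvaginSystems_idealOfBasis_propagatedSelmerStructure_of_towerSurj` — under the `3`-adic tower:
  (H.3) discharged too (n1011-p04 `hH3_three_of_towerSurj`); the (H.2) datum `τ` EXISTS by
  `exists_rootsOfUnityFixer_cokerSubOne_equiv_of_towerSurj` (p255331) and stays data (Sakamoto's
  primes depend on it).  This is the shape the route-1 assembly R1-23 (lower bound at `3` from a
  Kurihara-number certificate; n1011-p18) consumes.
* `kolyvaginSystems_idealOfBasis_levelOne_of_surj_of_localInputs` — LEVEL ONE (`k = 0`, `m = 1`,
  `T = T̄ = E[3]`, `R = 𝔽₃`) from surj(3) ALONE, assembled exactly like p260877's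
  `kolyvaginSystems_freeRankOne_levelOne_of_surj_of_localInputs`: (H.3) by p04's
  `hH3_of_hasSurjectiveModNGaloisRep W 3 0`, `hS'`/`hunr` by p05, the CORE RANK by p13's
  `hasCoreRank_one_propagatedSelmerStructureOne` (with `hbd`, `hKfin`, `hKSD` discharged).  Binders
  left: the fact `hS24₂`, `[Finite E[3]]`, surj(3), the `τ`-datum, the residual family `inv` ×4 +
  injectivity, `hEP`, (Lp) `hLpIm`, an admissible `S`, the Kolyvagin datum (all three EXIST from
  surj(3): p260877 `exists_kolyvaginDatum_…`), the full-level family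
  `inv' : LocalInvariants ℚ (3^(0+1))` ×4, the basis `κ` and the level `d`.  At `d = ∅` this is the
  input of row T-a5x (EXOTIC unit case): a level-one certificate `κ₁ ≠ 0` forces
  `N₁ = H¹_{𝓕_can^*}(ℚ, E[3]^∨(1)) = 0`.

What is NOT here: the certificate (Kato's Kolyvagin system at level one with unit bottom class),
any discharge of the two named facts, of the Poitou–Tate families or of (Lp); any class theorem.

References: R. Sakamoto, JTNB 36 (2024) Def. 4.2, Rem. 4.3, Thm. 4.4 (p. 926), Prop. 7.7
[Sakamoto2024]; B. Mazur, K. Rubin, Mem. AMS 799 (2004) Cor. 4.5.2 [MazurRubin2004]; K. Rubin,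
PCMS 18 (2011) §3.1 [Rubin2011]; J. H. Silverman, *AEC* III.8.1, X.4.2 [SilvermanAEC2009];
J. S. Milne, *ADT* I Thm. 2.8 [MilneADT2006].
-/

noncomputable section

open scoped Classical NumberField ContRepresentation
open Field NumberField IsDedekindDomain
open WeierstrassCurve Literature.NumberTheory.EllipticCurves Literature.NumberTheory.GaloisRepresentations
  Literature.NumberTheory.GaloisRepresentations.DiscreteGaloisModule Literature.NumberTheory.GaloisCohomology

namespace Summit.BirchSwinnertonDyer.Rank1Residual.GaloisImage

variable (W : WeierstrassCurve ℚ) [W.IsElliptic]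

/-! ### Every level, from surjectivity mod `3` -/

/-- **The N11 instance of Sakamoto's Thm. 4.4 (2) for `(E[3^{k+1}], 𝓕_can)` from surj(3).**  For a
basis `κ` of `KS₁(E[3^{k+1}], 𝓕_can, 𝒫(τ))` and a level `d`, with
`N_d = H¹_{𝓕_can(d)^*}(ℚ, E[3^{k+1}]^∨(1))` (dual Selmer group for the full-level Poitou–Tate family
`inv'`): `#N_d ∣ 3^{k+1} ⟹ ord(κ_d)·#N_d = 3^{k+1}` and `3^{k+1} ∣ #N_d ⟹ κ_d = 0`.  Discharged
here (theorems of the tree, as in p255331): the residual pair (`torsionMulBy_pow_surjective`,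
`torsionMulBy_pow_eq_zero_iff`, `torsionInclusion_torsionMulBy_pow`), the free finite
`ℤ/3^{k+1}`-module `E[3^{k+1}]` (global instances of `SakamotoN11Instance`), (H.1) from surj(3)
(`residual_irreducible_of_surj`), cartesian at every place (`isCartesian_propagatedSelmerStructure`),
`𝓕̄ = propagatedSelmerStructureOne W 3` (`induced_propagatedSelmerStructure`).  Explicit binders
(nothing hidden): `τ` (`hτμ`, `hτq`), (H.3) `hH3`, `θ`/`hθ`, `inv` ×4, `S` (`hS`, `hS'`, `hunr`),
core rank `hCR`, coisotropy `hco`, the datum (`D`, `η`, `hP`, `hT`, `hD`), the full-level family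
`inv'` ×4, the basis `κ`, the level `d`.  CONDITIONAL on the named fact `hS24₂`.
[cite: Sakamoto2024, Thm. 4.4 (2) (p. 926; = Prop. 7.7, p. 936)] -/
theorem kolyvaginSystems_idealOfBasis_propagatedSelmerStructure_of_surj
    (hS24₂ : Sakamoto2024.kolyvaginSystems_idealOfBasis_eq_fittingIdeal_zmod_three_pow) (k : ℕ)
    [Finite (geomTorsion W ((3 : ℕ) : ℤ))] [Finite (geomTorsion W (((3 : ℕ) : ℤ) ^ k * ((3 : ℕ) : ℤ)))]
    (h3 : W.HasSurjectiveModNGaloisRep ((3 : ℕ) : ℤ))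
    (τ : absoluteGaloisGroup ℚ) (hτμ : τ ∈ rootsOfUnityFixer ℚ (3 ^ (k + 1)))
    (hτq : Nonempty (cokerSubOne (W.torsionGaloisModule (((3 : ℕ) : ℤ) ^ k * ((3 : ℕ) : ℤ))) τ ≃+
      ZMod (3 ^ (k + 1))))
    (hH3 : ∀ f : contOneCocycles (W.torsionGaloisModule ((3 : ℕ) : ℤ)).toTopRep,
      (∀ u : absoluteGaloisGroup ℚ, (W.torsionGaloisModule (((3 : ℕ) : ℤ) ^ k * ((3 : ℕ) : ℤ))) u = 1 →
        u ∈ rootsOfUnityFixer ℚ (3 ^ (k + 1)) → f.1 u = 0) →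
        oneCocycleClass (W.torsionGaloisModule ((3 : ℕ) : ℤ)).toTopRep f = 0)
    (θ : (W.torsionGaloisModule ((3 : ℕ) : ℤ)).toContRepresentation →ⁱL
      ((W.torsionGaloisModule ((3 : ℕ) : ℤ)).tateDual 3).toContRepresentation)
    (hθ : Function.Bijective θ)
    (inv : LocalInvariants ℚ 3) (hperf : inv.IsPerfect) (hsum : inv.SumLocalTermEqZero)
    (hunro : inv.UnramifiedOrthogonal) (hcompl : inv.SelmerComplement)
    (S : Finset (Place ℚ)) (hS : ∀ w : InfinitePlace ℚ, (Sum.inl w : Place ℚ) ∈ S)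
    (hS' : ∀ v : HeightOneSpectrum (𝓞 ℚ), (Sum.inr v : Place ℚ) ∉ S →
      ((3 : ℕ) : 𝓞 ℚ) ∉ v.asIdeal ∧ GaloisRep.IsUnramifiedAt v
        (W.torsionGaloisModule (((3 : ℕ) : ℤ) ^ k * ((3 : ℕ) : ℤ))))
    (hunr : (propagatedSelmerStructure W 3 k).IsUnramifiedOutside S)
    (hCR : LocalInvariants.HasCoreRank inv (propagatedSelmerStructureOne W 3) 3 1)
    (hco : inv.IsResiduallyCoisotropic (propagatedSelmerStructureOne W 3) θ S)
    (D : KolyvaginDatum (W.torsionGaloisModule (((3 : ℕ) : ℤ) ^ k * ((3 : ℕ) : ℤ))))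
    (η : (q : HeightOneSpectrum (𝓞 ℚ)) → (ZMod (Ideal.absNorm q.asIdeal))ˣ)
    (hP : D.primes = frobeniusClassPrimes (W.torsionGaloisModule (((3 : ℕ) : ℤ) ^ k * ((3 : ℕ) : ℤ)))
      {v | (Sum.inr v : Place ℚ) ∈ S} τ (3 ^ (k + 1)))
    (hT : D.transverse =
      cyclotomicTransverse (W.torsionGaloisModule (((3 : ℕ) : ℤ) ^ k * ((3 : ℕ) : ℤ))))
    (hD : D.HasCanonicalComparison (3 ^ (k + 1)) η)
    (inv' : LocalInvariants ℚ (3 ^ (k + 1))) (hperf' : inv'.IsPerfect)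
    (hsum' : inv'.SumLocalTermEqZero) (hunro' : inv'.UnramifiedOrthogonal)
    (hcompl' : inv'.SelmerComplement)
    (κ : D.kolyvaginSystems (propagatedSelmerStructure W 3 k)) (hκ : AddSubgroup.zmultiples κ = ⊤)
    (d : Finset (HeightOneSpectrum (𝓞 ℚ))) (hd : D.IsLevel d) :
    (Nat.card (inv'.dualSelmerStructure (W.torsionGaloisModule (((3 : ℕ) : ℤ) ^ k * ((3 : ℕ) : ℤ)))
        (D.atLevel (propagatedSelmerStructure W 3 k) d)).selmerGroup ∣ 3 ^ (k + 1) →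
      addOrderOf (κ.1 d) *
        Nat.card (inv'.dualSelmerStructure (W.torsionGaloisModule (((3 : ℕ) : ℤ) ^ k * ((3 : ℕ) : ℤ)))
          (D.atLevel (propagatedSelmerStructure W 3 k) d)).selmerGroup = 3 ^ (k + 1)) ∧
    (3 ^ (k + 1) ∣ Nat.card (inv'.dualSelmerStructure
        (W.torsionGaloisModule (((3 : ℕ) : ℤ) ^ k * ((3 : ℕ) : ℤ)))
          (D.atLevel (propagatedSelmerStructure W 3 k) d)).selmerGroup → κ.1 d = 0) := by
  haveI : NeZero ((3 : ℕ) : ℚ) := ⟨by norm_num⟩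
  have hcart := isCartesian_propagatedSelmerStructure W 3 k S
  have hCR' : LocalInvariants.HasCoreRank inv
      ((propagatedSelmerStructure W 3 k).induced (W.torsionMulBy (((3 : ℕ) : ℤ) ^ k) ((3 : ℕ) : ℤ))) 3 1 := by
    rw [induced_propagatedSelmerStructure]; exact hCR
  have hco' : inv.IsResiduallyCoisotropic
      ((propagatedSelmerStructure W 3 k).induced (W.torsionMulBy (((3 : ℕ) : ℤ) ^ k) ((3 : ℕ) : ℤ))) θ S := by
    rw [induced_propagatedSelmerStructure]; exact hco
  exact hS24₂ (geomTorsion W (((3 : ℕ) : ℤ) ^ k * ((3 : ℕ) : ℤ))) (geomTorsion W ((3 : ℕ) : ℤ)) (k + 1)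
    (W.torsionGaloisModule _) (W.torsionGaloisModule _) (W.torsionMulBy (((3 : ℕ) : ℤ) ^ k) ((3 : ℕ) : ℤ))
    (W.torsionInclusion (Dvd.intro_left _ rfl)) τ θ inv S (propagatedSelmerStructure W 3 k) D η
    (torsionMulBy_pow_surjective W 3 k) (torsionMulBy_pow_eq_zero_iff W 3 k)
    (torsionInclusion_torsionMulBy_pow W 3 k) (residual_irreducible_of_surj W 3 h3) hτμ hτq
    hH3 hθ hperf hsum hunro hcompl hS hS' hunr hcart hCR' hco' hP hT hD
    inv' hperf' hsum' hunro' hcompl' κ hκ d hd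

/-- **Every level, from surj(3), with (H.SD) and the residual coisotropy DISCHARGED** by the Weil
choice of `θ` (n1011-p18's pattern: `exists_weilPairing_holds`, `X11b.LocBridge.weilDualHom_bijective`,
`isResiduallyCoisotropic_propagatedSelmerStructureOne_three`; price: Tate's `hEP` on the finite
places of `S`; both `Finite` instance binders stay, the statement needs them: `finite_geomTorsion_pow_mul`).  CONDITIONAL on `hS24₂`.
[cite: Sakamoto2024, Def. 3.8 (p. 924) and Thm. 4.4 (2) (p. 926)] -/
theorem kolyvaginSystems_idealOfBasis_propagatedSelmerStructure_weil_of_surj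
    (hS24₂ : Sakamoto2024.kolyvaginSystems_idealOfBasis_eq_fittingIdeal_zmod_three_pow) (k : ℕ)
    [Finite (geomTorsion W ((3 : ℕ) : ℤ))] [Finite (geomTorsion W (((3 : ℕ) : ℤ) ^ k * ((3 : ℕ) : ℤ)))]
    (h3 : W.HasSurjectiveModNGaloisRep ((3 : ℕ) : ℤ))
    (τ : absoluteGaloisGroup ℚ) (hτμ : τ ∈ rootsOfUnityFixer ℚ (3 ^ (k + 1)))
    (hτq : Nonempty (cokerSubOne (W.torsionGaloisModule (((3 : ℕ) : ℤ) ^ k * ((3 : ℕ) : ℤ))) τ ≃+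
      ZMod (3 ^ (k + 1))))
    (hH3 : ∀ f : contOneCocycles (W.torsionGaloisModule ((3 : ℕ) : ℤ)).toTopRep,
      (∀ u : absoluteGaloisGroup ℚ, (W.torsionGaloisModule (((3 : ℕ) : ℤ) ^ k * ((3 : ℕ) : ℤ))) u = 1 →
        u ∈ rootsOfUnityFixer ℚ (3 ^ (k + 1)) → f.1 u = 0) →
        oneCocycleClass (W.torsionGaloisModule ((3 : ℕ) : ℤ)).toTopRep f = 0)
    (inv : LocalInvariants ℚ 3) (hperf : inv.IsPerfect) (hsum : inv.SumLocalTermEqZero)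
    (hunro : inv.UnramifiedOrthogonal) (hcompl : inv.SelmerComplement)
    (S : Finset (Place ℚ)) (hS : ∀ w : InfinitePlace ℚ, (Sum.inl w : Place ℚ) ∈ S)
    (hS' : ∀ v : HeightOneSpectrum (𝓞 ℚ), (Sum.inr v : Place ℚ) ∉ S →
      ((3 : ℕ) : 𝓞 ℚ) ∉ v.asIdeal ∧ GaloisRep.IsUnramifiedAt v
        (W.torsionGaloisModule (((3 : ℕ) : ℤ) ^ k * ((3 : ℕ) : ℤ))))
    (hunr : (propagatedSelmerStructure W 3 k).IsUnramifiedOutside S)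
    (hEP : ∀ v : HeightOneSpectrum (𝓞 ℚ), (Sum.inr v : Place ℚ) ∈ S →
      localEulerPoincareCharacteristic (v.adicCompletion ℚ))
    (hCR : LocalInvariants.HasCoreRank inv (propagatedSelmerStructureOne W 3) 3 1)
    (D : KolyvaginDatum (W.torsionGaloisModule (((3 : ℕ) : ℤ) ^ k * ((3 : ℕ) : ℤ))))
    (η : (q : HeightOneSpectrum (𝓞 ℚ)) → (ZMod (Ideal.absNorm q.asIdeal))ˣ)
    (hP : D.primes = frobeniusClassPrimes (W.torsionGaloisModule (((3 : ℕ) : ℤ) ^ k * ((3 : ℕ) : ℤ)))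
      {v | (Sum.inr v : Place ℚ) ∈ S} τ (3 ^ (k + 1)))
    (hT : D.transverse =
      cyclotomicTransverse (W.torsionGaloisModule (((3 : ℕ) : ℤ) ^ k * ((3 : ℕ) : ℤ))))
    (hD : D.HasCanonicalComparison (3 ^ (k + 1)) η)
    (inv' : LocalInvariants ℚ (3 ^ (k + 1))) (hperf' : inv'.IsPerfect)
    (hsum' : inv'.SumLocalTermEqZero) (hunro' : inv'.UnramifiedOrthogonal)
    (hcompl' : inv'.SelmerComplement)
    (κ : D.kolyvaginSystems (propagatedSelmerStructure W 3 k)) (hκ : AddSubgroup.zmultiples κ = ⊤)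
    (d : Finset (HeightOneSpectrum (𝓞 ℚ))) (hd : D.IsLevel d) :
    (Nat.card (inv'.dualSelmerStructure (W.torsionGaloisModule (((3 : ℕ) : ℤ) ^ k * ((3 : ℕ) : ℤ)))
        (D.atLevel (propagatedSelmerStructure W 3 k) d)).selmerGroup ∣ 3 ^ (k + 1) →
      addOrderOf (κ.1 d) *
        Nat.card (inv'.dualSelmerStructure (W.torsionGaloisModule (((3 : ℕ) : ℤ) ^ k * ((3 : ℕ) : ℤ)))
          (D.atLevel (propagatedSelmerStructure W 3 k) d)).selmerGroup = 3 ^ (k + 1)) ∧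
    (3 ^ (k + 1) ∣ Nat.card (inv'.dualSelmerStructure
        (W.torsionGaloisModule (((3 : ℕ) : ℤ) ^ k * ((3 : ℕ) : ℤ)))
          (D.atLevel (propagatedSelmerStructure W 3 k) d)).selmerGroup → κ.1 d = 0) := by
  obtain ⟨e, hμ, hadd₁, hadd₂, halt, hnondeg, hgal⟩ :=
    exists_weilPairing_holds W 3 (by norm_num) (by norm_num)
  exact kolyvaginSystems_idealOfBasis_propagatedSelmerStructure_of_surj W hS24₂ k h3 τ hτμ hτq hH3
    (weilDualIntertwining W 3 e hμ hadd₁ hadd₂ hgal)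
    (X11b.LocBridge.weilDualHom_bijective W 3 e hμ hadd₁ hadd₂ hnondeg)
    inv hperf hsum hunro hcompl S hS hS' hunr hCR
    (isResiduallyCoisotropic_propagatedSelmerStructureOne_three W e hμ hadd₁ hadd₂ hgal halt hnondeg
      inv hperf S hEP)
    D η hP hT hD inv' hperf' hsum' hunro' hcompl' κ hκ d hd

/-- **Under the `3`-adic tower: (H.3) discharged as well** (n1011-p04's `hH3_three_of_towerSurj`);
the (H.2) datum `τ` EXISTS (`exists_rootsOfUnityFixer_cokerSubOne_equiv_of_towerSurj`, p255331)
and stays data because Sakamoto's primes depend on it.  The shape the route-1 assembly R1-23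
consumes (lower bound at `3` from a Kurihara-number certificate): binders `hS24₂`, `k`,
`[Finite E[3]]`, `[Finite E[3^k·3]]`, `htower`, `τ` (`hτμ`, `hτq`), `inv` ×4, `S` (`hS`, `hS'`, `hunr`), `hEP`, `hCR`,
the datum, `inv'` ×4, `κ`, `d`.  CONDITIONAL on `hS24₂`; nothing booked.
[cite: Sakamoto2024, §2 (H.3) (p. 921) and Thm. 4.4 (2) (p. 926)] -/
theorem kolyvaginSystems_idealOfBasis_propagatedSelmerStructure_of_towerSurj
    (hS24₂ : Sakamoto2024.kolyvaginSystems_idealOfBasis_eq_fittingIdeal_zmod_three_pow) (k : ℕ)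
    [Finite (geomTorsion W ((3 : ℕ) : ℤ))] [Finite (geomTorsion W (((3 : ℕ) : ℤ) ^ k * ((3 : ℕ) : ℤ)))]
    (htower : ∀ n : ℕ, W.HasSurjectiveModNGaloisRep (3 ^ n : ℕ))
    (τ : absoluteGaloisGroup ℚ) (hτμ : τ ∈ rootsOfUnityFixer ℚ (3 ^ (k + 1)))
    (hτq : Nonempty (cokerSubOne (W.torsionGaloisModule (((3 : ℕ) : ℤ) ^ k * ((3 : ℕ) : ℤ))) τ ≃+
      ZMod (3 ^ (k + 1))))
    (inv : LocalInvariants ℚ 3) (hperf : inv.IsPerfect) (hsum : inv.SumLocalTermEqZero)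
    (hunro : inv.UnramifiedOrthogonal) (hcompl : inv.SelmerComplement)
    (S : Finset (Place ℚ)) (hS : ∀ w : InfinitePlace ℚ, (Sum.inl w : Place ℚ) ∈ S)
    (hS' : ∀ v : HeightOneSpectrum (𝓞 ℚ), (Sum.inr v : Place ℚ) ∉ S →
      ((3 : ℕ) : 𝓞 ℚ) ∉ v.asIdeal ∧ GaloisRep.IsUnramifiedAt v
        (W.torsionGaloisModule (((3 : ℕ) : ℤ) ^ k * ((3 : ℕ) : ℤ))))
    (hunr : (propagatedSelmerStructure W 3 k).IsUnramifiedOutside S)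
    (hEP : ∀ v : HeightOneSpectrum (𝓞 ℚ), (Sum.inr v : Place ℚ) ∈ S →
      localEulerPoincareCharacteristic (v.adicCompletion ℚ))
    (hCR : LocalInvariants.HasCoreRank inv (propagatedSelmerStructureOne W 3) 3 1)
    (D : KolyvaginDatum (W.torsionGaloisModule (((3 : ℕ) : ℤ) ^ k * ((3 : ℕ) : ℤ))))
    (η : (q : HeightOneSpectrum (𝓞 ℚ)) → (ZMod (Ideal.absNorm q.asIdeal))ˣ)
    (hP : D.primes = frobeniusClassPrimes (W.torsionGaloisModule (((3 : ℕ) : ℤ) ^ k * ((3 : ℕ) : ℤ)))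
      {v | (Sum.inr v : Place ℚ) ∈ S} τ (3 ^ (k + 1)))
    (hT : D.transverse =
      cyclotomicTransverse (W.torsionGaloisModule (((3 : ℕ) : ℤ) ^ k * ((3 : ℕ) : ℤ))))
    (hD : D.HasCanonicalComparison (3 ^ (k + 1)) η)
    (inv' : LocalInvariants ℚ (3 ^ (k + 1))) (hperf' : inv'.IsPerfect)
    (hsum' : inv'.SumLocalTermEqZero) (hunro' : inv'.UnramifiedOrthogonal)
    (hcompl' : inv'.SelmerComplement)
    (κ : D.kolyvaginSystems (propagatedSelmerStructure W 3 k)) (hκ : AddSubgroup.zmultiples κ = ⊤)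
    (d : Finset (HeightOneSpectrum (𝓞 ℚ))) (hd : D.IsLevel d) :
    (Nat.card (inv'.dualSelmerStructure (W.torsionGaloisModule (((3 : ℕ) : ℤ) ^ k * ((3 : ℕ) : ℤ)))
        (D.atLevel (propagatedSelmerStructure W 3 k) d)).selmerGroup ∣ 3 ^ (k + 1) →
      addOrderOf (κ.1 d) *
        Nat.card (inv'.dualSelmerStructure (W.torsionGaloisModule (((3 : ℕ) : ℤ) ^ k * ((3 : ℕ) : ℤ)))
          (D.atLevel (propagatedSelmerStructure W 3 k) d)).selmerGroup = 3 ^ (k + 1)) ∧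
    (3 ^ (k + 1) ∣ Nat.card (inv'.dualSelmerStructure
        (W.torsionGaloisModule (((3 : ℕ) : ℤ) ^ k * ((3 : ℕ) : ℤ)))
          (D.atLevel (propagatedSelmerStructure W 3 k) d)).selmerGroup → κ.1 d = 0) :=
  kolyvaginSystems_idealOfBasis_propagatedSelmerStructure_weil_of_surj W hS24₂ k
    (by simpa using htower 1) τ hτμ hτq (hH3_three_of_towerSurj W k htower)
    inv hperf hsum hunro hcompl S hS hS' hunr hEP hCR D η hP hT hD inv' hperf' hsum' hunro' hcompl'
    κ hκ d hd

/-! ### Level one (`m = 1`, `T = T̄ = E[3]`) from surjectivity mod `3` alone, assembled -/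

/-- **Thm. 4.4 (2) at LEVEL ONE from surj(3) ALONE, with (H.3), `hS'`/`hunr` and the core rank
discharged** (exactly the discharges of p260877's
`kolyvaginSystems_freeRankOne_levelOne_of_surj_of_localInputs`: p04's
`hH3_of_hasSurjectiveModNGaloisRep W 3 0`, p05's `not_mem_and_isUnramifiedAt_of_not_mem` /
`propagatedSelmerStructure_isUnramifiedOutside`, p13's `hasCoreRank_one_propagatedSelmerStructureOne`
with `hbd` (p05), `hKfin` (Silverman X.4.2 (b)) and `hKSD` (p13, Weil pairing) discharged).  For a
basis `κ` of `KS₁(E[3], 𝓕_can, 𝒫(τ))` and a level `d`, with `N_d` the dual Selmer group of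
`𝓕_can(d)` for the full-level family `inv' : LocalInvariants ℚ (3^1)`: `#N_d ∣ 3 ⟹ ord(κ_d)·#N_d = 3`
and `3 ∣ #N_d ⟹ κ_d = 0`.  Binders left (nothing hidden): `hS24₂`, `[Finite E[3]]`, `[Finite E[3^0·3]]` (theorem
`finite_geomTorsion_pow_mul W 3 0`), surj(3), the
`τ`-datum (exists: p260356), the residual family `inv` ×4, `hEP`, **(Lp) `hLpIm`**, an
admissible `S ⊇ ∞ ∪ {3} ∪ {bad}`, the Kolyvagin datum (exists: p260877), `inv'` ×4, `κ`, `d`.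
No tower: applies on every surj(3) row incl. EXOTIC.  At `d = ∅` it is the T-a5x link "a level-one
certificate `κ₁ ≠ 0` forces `N₁ = 0`".  CONDITIONAL on `hS24₂`; nothing booked; no mark changed.
[cite: Sakamoto2024, Def. 3.6 (p. 923), Def. 3.8 (p. 924) and Thm. 4.4 (2) (p. 926)] -/
theorem kolyvaginSystems_idealOfBasis_levelOne_of_surj_of_localInputs
    (hS24₂ : Sakamoto2024.kolyvaginSystems_idealOfBasis_eq_fittingIdeal_zmod_three_pow)
    [Finite (geomTorsion W ((3 : ℕ) : ℤ))] [Finite (geomTorsion W (((3 : ℕ) : ℤ) ^ 0 * ((3 : ℕ) : ℤ)))]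
    (h3 : W.HasSurjectiveModNGaloisRep ((3 : ℕ) : ℤ))
    (τ : absoluteGaloisGroup ℚ) (hτμ : τ ∈ rootsOfUnityFixer ℚ (3 ^ (0 + 1)))
    (hτq : Nonempty (cokerSubOne (W.torsionGaloisModule (((3 : ℕ) : ℤ) ^ 0 * ((3 : ℕ) : ℤ))) τ ≃+
      ZMod (3 ^ (0 + 1))))
    (inv : LocalInvariants ℚ 3) (hperf : inv.IsPerfect) (hsum : inv.SumLocalTermEqZero)
    (hunro : inv.UnramifiedOrthogonal) (hcompl : inv.SelmerComplement)
    (hEP : ∀ v : HeightOneSpectrum (𝓞 ℚ), localEulerPoincareCharacteristic (v.adicCompletion ℚ))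
    (hLpIm : ∀ v : HeightOneSpectrum (𝓞 ℚ), ((3 : ℕ) : 𝓞 ℚ) ∈ v.asIdeal →
      Nat.card (propagatedSelmerStructureOne W 3 (Sum.inr v)) =
        9 * Nat.card (nsmulAddMonoidHom 3 :
          (W.baseChange (v.adicCompletion ℚ)).toAffine.Point →+ _).ker)
    (S : Finset (Place ℚ)) (hS : ∀ w : InfinitePlace ℚ, (Sum.inl w : Place ℚ) ∈ S)
    (h3S : ∀ v : HeightOneSpectrum (𝓞 ℚ), ((3 : ℕ) : 𝓞 ℚ) ∈ v.asIdeal → (Sum.inr v : Place ℚ) ∈ S)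
    (hbadS : ∀ v : HeightOneSpectrum (𝓞 ℚ), ¬ W.HasGoodReductionAt v → (Sum.inr v : Place ℚ) ∈ S)
    (D : KolyvaginDatum (W.torsionGaloisModule (((3 : ℕ) : ℤ) ^ 0 * ((3 : ℕ) : ℤ))))
    (η : (q : HeightOneSpectrum (𝓞 ℚ)) → (ZMod (Ideal.absNorm q.asIdeal))ˣ)
    (hP : D.primes = frobeniusClassPrimes (W.torsionGaloisModule (((3 : ℕ) : ℤ) ^ 0 * ((3 : ℕ) : ℤ)))
      {v | (Sum.inr v : Place ℚ) ∈ S} τ (3 ^ (0 + 1)))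
    (hT : D.transverse =
      cyclotomicTransverse (W.torsionGaloisModule (((3 : ℕ) : ℤ) ^ 0 * ((3 : ℕ) : ℤ))))
    (hD : D.HasCanonicalComparison (3 ^ (0 + 1)) η)
    (inv' : LocalInvariants ℚ (3 ^ (0 + 1))) (hperf' : inv'.IsPerfect)
    (hsum' : inv'.SumLocalTermEqZero) (hunro' : inv'.UnramifiedOrthogonal)
    (hcompl' : inv'.SelmerComplement)
    (κ : D.kolyvaginSystems (propagatedSelmerStructure W 3 0)) (hκ : AddSubgroup.zmultiples κ = ⊤)
    (d : Finset (HeightOneSpectrum (𝓞 ℚ))) (hd : D.IsLevel d) :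
    (Nat.card (inv'.dualSelmerStructure (W.torsionGaloisModule (((3 : ℕ) : ℤ) ^ 0 * ((3 : ℕ) : ℤ)))
        (D.atLevel (propagatedSelmerStructure W 3 0) d)).selmerGroup ∣ 3 ^ (0 + 1) →
      addOrderOf (κ.1 d) *
        Nat.card (inv'.dualSelmerStructure (W.torsionGaloisModule (((3 : ℕ) : ℤ) ^ 0 * ((3 : ℕ) : ℤ)))
          (D.atLevel (propagatedSelmerStructure W 3 0) d)).selmerGroup = 3 ^ (0 + 1)) ∧
    (3 ^ (0 + 1) ∣ Nat.card (inv'.dualSelmerStructure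
        (W.torsionGaloisModule (((3 : ℕ) : ℤ) ^ 0 * ((3 : ℕ) : ℤ)))
          (D.atLevel (propagatedSelmerStructure W 3 0) d)).selmerGroup → κ.1 d = 0) := by
  haveI : Fact (Nat.Prime 3) := ⟨Nat.prime_three⟩
  -- the finite places of `S`
  let T : Finset (HeightOneSpectrum (𝓞 ℚ)) := S.preimage Sum.inr Sum.inr_injective.injOn
  have h3T : ∀ v : HeightOneSpectrum (𝓞 ℚ), ((3 : ℕ) : 𝓞 ℚ) ∈ v.asIdeal → v ∈ T :=
    fun v hv => Finset.mem_preimage.mpr (h3S v hv)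
  have hbadT : ∀ v : HeightOneSpectrum (𝓞 ℚ), ¬ W.HasGoodReductionAt v → v ∈ T :=
    fun v hv => Finset.mem_preimage.mpr (hbadS v hv)
  -- `Sel^{(3)}(E/ℚ)` is finite (Silverman X.4.2 (b))
  have hKfin : Finite (W.kummerSelmerStructure ((3 : ℕ) : ℤ)).selmerGroup := by
    rw [← selmerGroup_eq_selmerGroup_kummerSelmerStructure]
    exact W.finite_selmerGroup_holds (by norm_num)
  -- the residual self-duality count of the `3`-descent structure (Weil pairing on `E[3]`)
  obtain ⟨e, hμ, hadd₁, hadd₂, halt, hnondeg, hgal⟩ :=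
    exists_weilPairing_holds W 3 (by norm_num) (by norm_num)
  haveI := hKfin
  have hKSD := natCard_selmerGroup_kummer_eq_dual W 3 e hμ hadd₁ hadd₂ hgal halt hnondeg
    Nat.prime_three.isPrimePow (by decide) inv (fun v => (hperf v).1.injective) hEP
  -- the core rank `χ(𝓕̄_can) = 1`, modulo (Lp)
  have hCR : LocalInvariants.HasCoreRank inv (propagatedSelmerStructureOne W 3) 3 1 :=
    hasCoreRank_one_propagatedSelmerStructureOne W inv hperf hsum hcompl T h3T hbadT
      (fun v hv => bounded_pPrimaryTorsion_localGaloisModule_rat W 3 hv) hKfin hKSD hLpIm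
  exact kolyvaginSystems_idealOfBasis_propagatedSelmerStructure_weil_of_surj W hS24₂ 0 h3 τ hτμ hτq
    (hH3_of_hasSurjectiveModNGaloisRep W 3 0 (by decide)
      (by simpa only [pow_zero, one_mul] using h3))
    inv hperf hsum hunro hcompl S hS
    (fun v hv => not_mem_and_isUnramifiedAt_of_not_mem W 3 0 S h3S hbadS hv)
    (propagatedSelmerStructure_isUnramifiedOutside W 3 0 S hS h3S hbadS)
    (fun v _ => hEP v) hCR D η hP hT hD inv' hperf' hsum' hunro' hcompl' κ hκ d hd

end Summit.BirchSwinnertonDyer.Rank1Residual.GaloisImage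

end
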